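import Literature.MathematicalPhysics.QuantumFieldTheory.Balaban1983to89.B4GaussRep36Proof

/-!
# `Balaban1983to89.B4Prop23Sect3Route` — T. Bałaban, *Regularity and decay of lattice Green's functions*, Commun.
# Math. Phys. **89** (1983) 571–597 [Balaban1983RegularityDecay], Sect. 3 pp. 588–589: the closing sentences of the
# §3 proof of «Proposition 2.3 of [1]» — the kernel bounds (1.16), (1.18) (and the (1.20) step) for the unit-lattice
# propagators `C^{(k)}_Λ(Ω,A)` DERIVED from the representation (3.6)/(3.8), the estimate (3.10) and the Corollary 2.3
# decay of the two-scale propagator `G_k(Ω,Λ,A)`, over the plain-matrix dictionary of `B4GaussRep36`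

statement-level skeleton of published theorems with citation tags; proofs where landed; nothing here is a claim about the Yang–Mills mass gap

PDF held: `paper:balaban1983-cmp89-regularity-decay` (journal page = PDF page + 570); renders
`run/shared/lean/pub/pub-balaban/b2b-balaban-ref1/pages/1983-cmp89-regularity-decay/1983-cmp89-regularity-decay-p004-x2.png`
(Prop. 2.3 of [1], (1.15)–(1.20)), `…-p018-x2.png`, `…-p019-x2.png` (§3, (3.6)–(3.10)) read as images.

CITATION HEADER (lean-in-tree rule).  lit-balaban cell (HOME `run/shared/lean/pub/lit-balaban/`), unit `lit-balaban-r01`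
(reader/typer of CMP 89 = block B4, paper fold owner; gen 3), SKELETON rows `B4.Prop2.3[I]` (`B4.Prop23Printed`,
typed-existing; proved at `A = 0` in `B4Prop23ZeroBox`/`B4Prop23ZeroRegion`), `B4.Eq3.6` (PROVED p240595
`B4GaussRep36Proof.rep36`), `B4.Eq3.7`/(3.8) (`B4GaussRep36.tOp`, `eq38`), `B4.Eq3.10` (PROVED p243107
`B4Ineq310Proof.ineq310`, decl of record `B4GaussRep36.Ineq310`).  This module PROVES, for every gauge field (i.e. for
arbitrary data of the dictionary), the two in-text inferences by which §3 ends: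

p. 588 [PDF 18], verbatim: *"The L²-norms of the functions q_k(y), q_{k+1}(y) are equal to 1, L^{−d/2} and their
supports are in B^k(y), B^{k+1}(z(y)) respectively, so the inequalities (1.11), (1.12), and (1.16) ⟦= (1.15), (1.16),
(1.20): the in-text references to §1 displays in [B4] are low by four, cell census⟧ are simple consequences of Corollary
2.3."*  p. 589 [PDF 19], verbatim: *"The function δC^{(k)}_Λ(Ω,A) is given by (3.8) with the operator (3.9) instead of
G_k(Ω,Λ,A) and the inequality (3.10) implies (1.14) ⟦= (1.18)⟧. This ends the proof of Proposition I.2.3."*  The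
targets (p. 574 [PDF 4], verbatim): *"|C^{(k)}_Λ(Ω,A; x,x′)| ≤ c₀ exp(−δ₀|x−x′|), x, x′ ∈ Λ. (1.16) In particular the
above inequality holds for C^{(k)}(Ω,A). Putting δC^{(k)}_Λ(Ω,A) = C^{(k)}_Λ(Ω,A) − C^{(k)}(Ω,A), (1.17) we have also
|δC^{(k)}_Λ(Ω,A; x,x′)| ≤ c₀ exp(−δ₀(|x−x′| + dist(x,Λᶜ) + dist(x′,Λᶜ))), x, x′ ∈ Λ. (1.18) Finally, for Ω ⊂ Ω₀ and
δC^{(k)}_Λ(Ω,Ω₀,A) = C^{(k)}_Λ(Ω,A) − C^{(k)}_Λ(Ω₀,A), (1.19) we have |δC^{(k)}_Λ(Ω,Ω₀,A; x,x′)| ≤ c₀ exp(−δ₀(|x−x′| +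
dist(x,Ω^{(k)c}) + dist(x′,Ω^{(k)c}))), x, x′ ∈ Λ. (1.20)"*.

WHAT IS REPRODUCED (kernel, zero `sorry`; HYPOTHESES are exactly the printed inputs, as explicit binders — nothing of
Corollary 2.3 or of (3.10) is proved here, they ENTER as in the print):
* `cLam_apply_eq`: the kernel of `C^{(k)}_Λ(Ω,A)` as the pairing (3.8) of the rows `t_y = −(a_{k+1}/a_k)L^{−2}q_{k+1}(y)
  + q_k(y)` of `tOp` — from the PROVED (3.6) (`h36 : cLam = rep36Rhs`, i.e. `B4GaussRep36Proof.rep36`);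
* `abs_cLam_le` = **(1.16)** in support form: Cor 2.3 (2.30) for `G_k(Ω,Λ,A)` (hypothesis `hG`, the shape used by
  `B4Ineq310Proof.ineq310`) + `supp t_y ⊆ S_y` + `t_y·t_y ≤ c_k` (the two halves of the p. 588 sentence, discharged for
  the lattice block averaging in `…B4Sect3BlockAveraging`) ⇒ `|C^{(k)}_Λ(y,y′)| ≤ cκc_k·e^{−δ·dist(S_y,S_{y′})} +
  (a_{k+1}L^{−2}/a_k²)|P(y,y′)| + δ_{yy′}/a_k`; `abs_cLam_le_exp` = (1.16) AS PRINTED, `≤ c₁e^{−δ|y−y′|}` with the explicit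
  `c₁ = (cκc_k + a_{k+1}L^{−2}/a_k² + a_k⁻¹)e^{δρ}`, once the unit-lattice distance is dominated by the support distance up
  to the block diameter `ρ` (explicit geometric hypotheses `hρS`, `hρP`, `hρ0`);
* `tOp_univ_apply`, `deltaC_apply_eq`: *"δC^{(k)}_Λ(Ω,A) is given by (3.8) with the operator (3.9) instead of
  G_k(Ω,Λ,A)"* — PROVED: for `y, y′ ∈ Λ`, `δC^{(k)}_Λ(y,y′) = ⟨t_y, (G_k(Ω,Λ,A) − G^η_{k+1}(Ω,A))t_{y′}⟩` (the `P` and `δ`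
  terms of (3.6) cancel, the rows of `T` at `Λ` and at `Ω^{(k)}` agree by `BlockCompatible`);
* `abs_deltaC_le` = **(1.18)** in support form from `B4GaussRep36.Ineq310` (the PROVED row (3.10), hypothesis `h310`):
  `|δC^{(k)}_Λ(y,y′)| ≤ c₀κc_k·exp[−δ₀(dist(S_y,S_{y′}) + dist(S_y,B^k(Λ^c)) + dist(S_{y′},B^k(Λ^c)))]`; `abs_deltaC_le_exp` =
  (1.18) AS PRINTED with `c₀κc_k e^{3δ₀ρ}`;
* `abs_deltaC_region_le` = the **(1.20)** step in the same currency: for two background operators `H` (for `Ω`) and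
  `H₀` (for `Ω₀ ⊃ Ω`) realised on a common site set (block-diagonal extension; `T` does not depend on `H`),
  `δC^{(k)}_Λ(Ω,Ω₀,A) = T[G_k(Ω,Λ,A) − G_k(Ω₀,Λ,A)]Tᵀ` and the second member of (2.30) gives (1.20);
* `abs_mul_mul_transpose_apply_le`: the generic "kernel bound from a bilinear Cor 2.3-shape bound" behind all three.
* (v1.1, §5) `dist_le_sdist_add`, `distLc_le_sdist_add`, `dist_le_of_pOp_ne_zero`, `abs_cLam_le_dist`, `abs_deltaC_le_dist`:
  the block-diameter hypotheses of the point forms DERIVED from a metric embedding of the lattices (triangle inequality,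
  glb property of the set distance), giving (1.16)/(1.18) with `|y−y′| = dist(y,y′)` read in the embedding.
The form bounds (1.15) are not treated in this file; the structure hypotheses (`RowOrtho`, `BlockCompatible`, supports
and norms of the rows of `T`) are discharged for the lattice block averaging in `…B4Sect3BlockAveraging` (same unit).  No
definition is introduced.
-/

namespace Literature.MathematicalPhysics.QuantumFieldTheory.Balaban1983to89.B4Prop23Sect3Route

open Matrix Finset B4GaussRep36

variable {X Y Z : Type*}

/-! ## §0. Helpers -/

/-- `(TMTᵀ)(y,y′) = ⟨t_y, Mt_{y′}⟩` (plain pairing of the rows of `T`). [folklore] -/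
private theorem mul_mul_transpose_apply [Fintype X] {Λ : Type*} (T : Matrix Λ X ℝ) (M : Matrix X X ℝ)
    (y y' : Λ) : (T * M * Tᵀ) y y' = (fun x => T y x) ⬝ᵥ (M *ᵥ fun x => T y' x) := by
  rw [Matrix.mul_assoc, Matrix.mul_apply]
  simp only [Matrix.mul_apply, Matrix.transpose_apply, Matrix.mulVec, dotProduct]

/-- AM–GM for the weighted norms: `nrm t·nrm t′ ≤ κβ` if `nrm² = κ(·,·)` and both plain square norms are `≤ β`. [folklore] -/
private theorem nrm_mul_nrm_le [Fintype X] {nrm : (X → ℝ) → ℝ} {κ β : ℝ}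
    (hn2 : ∀ u, nrm u ^ 2 = κ * (u ⬝ᵥ u)) (hκ : 0 ≤ κ) {t t' : X → ℝ} (ht : t ⬝ᵥ t ≤ β)
    (ht' : t' ⬝ᵥ t' ≤ β) : nrm t * nrm t' ≤ κ * β := by
  have h1 : nrm t ^ 2 ≤ κ * β := by rw [hn2]; exact mul_le_mul_of_nonneg_left ht hκ
  have h2 : nrm t' ^ 2 ≤ κ * β := by rw [hn2]; exact mul_le_mul_of_nonneg_left ht' hκ
  nlinarith [sq_nonneg (nrm t - nrm t')]

/-- From a Cor 2.3-shape bound `c·nrm t·nrm t′·E` to `cκβ·E`. [folklore] -/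
private theorem bilinear_to_const [Fintype X] {nrm : (X → ℝ) → ℝ} {κ β c E v : ℝ}
    (hn2 : ∀ u, nrm u ^ 2 = κ * (u ⬝ᵥ u)) (hκ : 0 ≤ κ) (hc : 0 ≤ c) (hE : 0 ≤ E) {t t' : X → ℝ}
    (ht : t ⬝ᵥ t ≤ β) (ht' : t' ⬝ᵥ t' ≤ β) (hv : v ≤ c * nrm t * nrm t' * E) : v ≤ c * (κ * β) * E := by
  refine hv.trans ?_
  have h := nrm_mul_nrm_le hn2 hκ ht ht'
  calc c * nrm t * nrm t' * E = c * (nrm t * nrm t') * E := by ring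
    _ ≤ c * (κ * β) * E := mul_le_mul_of_nonneg_right (mul_le_mul_of_nonneg_left h hc) hE

/-! ## §1. The generic step: kernel bounds from bilinear (Corollary 2.3-shape) bounds -/

/-- THE GENERIC STEP behind *"so the inequalities … are simple consequences of Corollary 2.3"* (p. 588): if the rows
`t_y` of `T` have plain square norms `≤ β`, and `M` obeys a Corollary 2.3-shape bilinear bound `|⟨t_y, Mt_{y′}⟩| ≤
c·‖t_y‖·‖t_{y′}‖·E(y,y′)` (`‖u‖² = κ(u·u)`), then `|(TMTᵀ)(y,y′)| ≤ cκβ·E(y,y′)`.  With `T = tOp` (3.6) and `M =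
G_k(Ω,Λ,A)`, `G_k(Ω,Λ,A) − G^η_{k+1}(Ω,A)` (3.9), `G_k(Ω,Λ,A) − G_k(Ω₀,Λ,A)` this is (1.16), (1.18), (1.20).
[cite: Balaban1983RegularityDecay, (3.8) p.588] -/
theorem abs_mul_mul_transpose_apply_le [Fintype X] {Λ : Type*} (T : Matrix Λ X ℝ) (M : Matrix X X ℝ)
    {nrm : (X → ℝ) → ℝ} {κ β c : ℝ} (E : Λ → Λ → ℝ) (hn2 : ∀ u, nrm u ^ 2 = κ * (u ⬝ᵥ u)) (hκ : 0 ≤ κ)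
    (hc : 0 ≤ c) (hE : ∀ y y', 0 ≤ E y y')
    (hT : ∀ y, (fun x => T y x) ⬝ᵥ (fun x => T y x) ≤ β)
    (hM : ∀ y y', |(fun x => T y x) ⬝ᵥ (M *ᵥ fun x => T y' x)| ≤
      c * nrm (fun x => T y x) * nrm (fun x => T y' x) * E y y')
    (y y' : Λ) : |(T * M * Tᵀ) y y'| ≤ c * (κ * β) * E y y' := by
  rw [mul_mul_transpose_apply]
  exact bilinear_to_const hn2 hκ hc (hE y y') (hT y) (hT y') (hM y y')

/-! ## §2. (1.16) from (3.6)/(3.8) and Corollary 2.3 for `G_k(Ω,Λ,A)` -/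

section Kernel16

variable [Fintype X] [Fintype Y] [Fintype Z] [DecidableEq X] [DecidableEq Y] [DecidableEq Z]

/-- **(3.8) as an identity of real numbers, from the proved (3.6)**: whenever `C^{(k)}_Λ(Ω,A) = TG_k(Ω,Λ,A)Tᵀ −
(a_{k+1}/a_k²)L^{−2}P|_Λ + a_k⁻¹1_Λ` (`h36`, i.e. `B4GaussRep36Proof.rep36`), the kernel is *"C^{(k)}_Λ(Ω,A;y,y′) =
⟨−(a_{k+1}/a_k)L^{−2}q_{k+1}(y) + q_k(y), G_k(Ω,Λ,A)(−(a_{k+1}/a_k)L^{−2}q_{k+1}(y′) + q_k(y′))⟩ − (a_{k+1}/a_k²)L^{−2}P(A;y,y′)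
+ δ_{y,y′}/a_k. (3.8)"* with the rows `t_y` of `tOp` as the functions (cf. `B4GaussRep36.eq38`, `tOp_row`).
[cite: Balaban1983RegularityDecay, (3.8) p.588] -/
theorem cLam_apply_eq {H : Matrix X X ℝ} {ak : ℝ} {Qk : Matrix Y X ℝ} {a ℓ w : ℝ} {Q : Matrix Z Y ℝ}
    {Λ : Finset Y} {Λ' : Finset Z} (h36 : cLam H ak Qk a ℓ w Q Λ = rep36Rhs H ak Qk a ℓ w Q Λ Λ') (y y' : Λ) :
    cLam H ak Qk a ℓ w Q Λ y y' =
      (fun x => tOp ak Qk a ℓ w Q Λ Λ' y x) ⬝ᵥ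
          (gLam H ak Qk a ℓ w Q Λ Λ' *ᵥ fun x => tOp ak Qk a ℓ w Q Λ Λ' y' x)
        - aNext a ak ℓ * ℓ / ak ^ 2 * pOp w Q y y' + (if y = y' then 1 / ak else 0) := by
  rw [h36, rep36Rhs, Matrix.add_apply, Matrix.sub_apply, mul_mul_transpose_apply, Matrix.smul_apply,
    Matrix.submatrix_apply, Matrix.smul_apply, Matrix.one_apply, smul_eq_mul, smul_eq_mul, mul_ite, mul_one,
    mul_zero]
  rw [show aNext a ak ℓ / ak ^ 2 * ℓ = aNext a ak ℓ * ℓ / ak ^ 2 from by ring]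

/-- **(1.16), support form** — *"|C^{(k)}_Λ(Ω,A; x,x′)| ≤ c₀ exp(−δ₀|x−x′|), x, x′ ∈ Λ (1.16)"* as *"simple
consequence of Corollary 2.3"* (p. 588): given (3.6) (`h36`), the Corollary 2.3 (2.30) bilinear decay of
`G_k(Ω,Λ,A)` with constants `(c, δ)` for arbitrarily supported test functions (`hG` — the INPUT, asserted in print
*"with only slight changes"*, census G-B4-04; same binder as in `B4Ineq310Proof.ineq310`), supports `supp t_y ⊆ S_y`
(`hS`) and plain square norms `t_y·t_y ≤ c_k` (`hT`) of the functions of (3.8) (*"The L²-norms of the functions q_k(y),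
q_{k+1}(y) are equal to 1, L^{−d/2} and their supports are in B^k(y), B^{k+1}(z(y))"*), a weighted Euclidean norm
`‖u‖² = κ(u·u)`:  `|C^{(k)}_Λ(y,y′)| ≤ cκc_k·e^{−δ·dist(S_y,S_{y′})} + (a_{k+1}L^{−2}/a_k²)|P(A;y,y′)| + δ_{yy′}/a_k`.
[cite: Balaban1983RegularityDecay, Prop. 2.3 of [1] (1.16) p.574, (3.8) p.588] -/
theorem abs_cLam_le {H : Matrix X X ℝ} {ak : ℝ} {Qk : Matrix Y X ℝ} {a ℓ w : ℝ} {Q : Matrix Z Y ℝ}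
    {Λ : Finset Y} {Λ' : Finset Z} {nrm : (X → ℝ) → ℝ} {sdist : Finset X → Finset X → ℝ} {κ ck c δ : ℝ}
    (S : Λ → Finset X) (h36 : cLam H ak Qk a ℓ w Q Λ = rep36Rhs H ak Qk a ℓ w Q Λ Λ')
    (hS : ∀ (y : Λ) (x : X), x ∉ S y → tOp ak Qk a ℓ w Q Λ Λ' y x = 0)
    (hT : ∀ y : Λ, (fun x => tOp ak Qk a ℓ w Q Λ Λ' y x) ⬝ᵥ (fun x => tOp ak Qk a ℓ w Q Λ Λ' y x) ≤ ck)
    (hn2 : ∀ u, nrm u ^ 2 = κ * (u ⬝ᵥ u)) (hκ : 0 ≤ κ) (hc : 0 ≤ c) (hak : 0 < ak)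
    (hθ : 0 ≤ aNext a ak ℓ * ℓ)
    (hG : ∀ (g g' : X → ℝ) (T T' : Finset X), (∀ x ∉ T, g x = 0) → (∀ x ∉ T', g' x = 0) →
      |g ⬝ᵥ (gLam H ak Qk a ℓ w Q Λ Λ' *ᵥ g')| ≤ c * nrm g * nrm g' * Real.exp (-(δ * sdist T T')))
    (y y' : Λ) :
    |cLam H ak Qk a ℓ w Q Λ y y'| ≤
      c * (κ * ck) * Real.exp (-(δ * sdist (S y) (S y'))) +
        aNext a ak ℓ * ℓ / ak ^ 2 * |pOp w Q y y'| + (if y = y' then 1 / ak else 0) := by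
  rw [cLam_apply_eq h36]
  set t : X → ℝ := fun x => tOp ak Qk a ℓ w Q Λ Λ' y x with htdef
  set t' : X → ℝ := fun x => tOp ak Qk a ℓ w Q Λ Λ' y' x with ht'def
  set A : ℝ := t ⬝ᵥ (gLam H ak Qk a ℓ w Q Λ Λ' *ᵥ t') with hA
  set b : ℝ := aNext a ak ℓ * ℓ / ak ^ 2 * pOp w Q y y' with hb
  set i : ℝ := (if y = y' then 1 / ak else (0 : ℝ)) with hi
  have hAle : |A| ≤ c * (κ * ck) * Real.exp (-(δ * sdist (S y) (S y'))) :=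
    bilinear_to_const hn2 hκ hc (Real.exp_pos _).le (hT y) (hT y') (hG t t' (S y) (S y') (hS y) (hS y'))
  have hcoef : 0 ≤ aNext a ak ℓ * ℓ / ak ^ 2 := div_nonneg hθ (sq_nonneg _)
  have hbabs : |b| = aNext a ak ℓ * ℓ / ak ^ 2 * |pOp w Q y y'| := by
    rw [hb, abs_mul, abs_of_nonneg hcoef]
  have hi0 : 0 ≤ i := by
    rw [hi]; split_ifs
    · exact (one_div_pos.mpr hak).le
    · exact le_rfl
  have hAb : |A - b| ≤ |A| + |b| := by simpa [sub_eq_add_neg, abs_neg] using abs_add_le A (-b)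
  calc |A - b + i| ≤ |A - b| + |i| := abs_add_le _ _
    _ ≤ |A| + |b| + i := by rw [abs_of_nonneg hi0]; linarith
    _ ≤ c * (κ * ck) * Real.exp (-(δ * sdist (S y) (S y'))) + aNext a ak ℓ * ℓ / ak ^ 2 * |pOp w Q y y'| + i := by
        rw [hbabs]; linarith

/-- **(1.16) AS PRINTED (point form, explicit constant)**: if moreover the unit-lattice distance is dominated by the
support distance up to the block diameter `ρ` — `|y−y′| ≤ dist(S_y,S_{y′}) + ρ` (`supp t_y ⊆ B^{k+1}(z(y))`),
`P(A;y,y′) ≠ 0 ⇒ |y−y′| ≤ ρ` (an `L`-block), `|y−y| ≤ ρ` — and `|P(A;y,y′)| ≤ 1` (a projection), then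
`|C^{(k)}_Λ(Ω,A;y,y′)| ≤ c₁e^{−δ|y−y′|}` with `c₁ = (cκc_k + a_{k+1}L^{−2}/a_k² + a_k⁻¹)e^{δρ}` — *"|C^{(k)}_Λ(Ω,A; x,x′)|
≤ c₀ exp(−δ₀|x−x′|), x, x′ ∈ Λ. (1.16)"*. [cite: Balaban1983RegularityDecay, Prop. 2.3 of [1] (1.16) p.574, (3.8) p.588] -/
theorem abs_cLam_le_exp {H : Matrix X X ℝ} {ak : ℝ} {Qk : Matrix Y X ℝ} {a ℓ w : ℝ} {Q : Matrix Z Y ℝ}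
    {Λ : Finset Y} {Λ' : Finset Z} {nrm : (X → ℝ) → ℝ} {sdist : Finset X → Finset X → ℝ} {κ ck c δ : ℝ}
    (S : Λ → Finset X) (h36 : cLam H ak Qk a ℓ w Q Λ = rep36Rhs H ak Qk a ℓ w Q Λ Λ')
    (hS : ∀ (y : Λ) (x : X), x ∉ S y → tOp ak Qk a ℓ w Q Λ Λ' y x = 0)
    (hT : ∀ y : Λ, (fun x => tOp ak Qk a ℓ w Q Λ Λ' y x) ⬝ᵥ (fun x => tOp ak Qk a ℓ w Q Λ Λ' y x) ≤ ck)
    (hn2 : ∀ u, nrm u ^ 2 = κ * (u ⬝ᵥ u)) (hκ : 0 ≤ κ) (hc : 0 ≤ c) (hck : 0 ≤ ck)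
    (hak : 0 < ak) (hθ : 0 ≤ aNext a ak ℓ * ℓ)
    (hG : ∀ (g g' : X → ℝ) (T T' : Finset X), (∀ x ∉ T, g x = 0) → (∀ x ∉ T', g' x = 0) →
      |g ⬝ᵥ (gLam H ak Qk a ℓ w Q Λ Λ' *ᵥ g')| ≤ c * nrm g * nrm g' * Real.exp (-(δ * sdist T T')))
    {udist : Y → Y → ℝ} {ρ : ℝ} (hδ : 0 ≤ δ) (hρS : ∀ y y' : Λ, udist y y' ≤ sdist (S y) (S y') + ρ)
    (hρP : ∀ y y' : Λ, pOp w Q y y' ≠ 0 → udist y y' ≤ ρ) (hρ0 : ∀ y : Λ, udist y y ≤ ρ)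
    (hP1 : ∀ y y' : Λ, |pOp w Q y y'| ≤ 1) (y y' : Λ) :
    |cLam H ak Qk a ℓ w Q Λ y y'| ≤
      (c * (κ * ck) + aNext a ak ℓ * ℓ / ak ^ 2 + 1 / ak) * Real.exp (δ * ρ) *
        Real.exp (-(δ * udist y y')) := by
  have h := abs_cLam_le S h36 hS hT hn2 hκ hc hak hθ hG y y'
  set E : ℝ := Real.exp (δ * ρ) * Real.exp (-(δ * udist y y')) with hE
  have hE' : E = Real.exp (δ * ρ - δ * udist y y') := by rw [hE, ← Real.exp_add, sub_eq_add_neg]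
  have hEpos : 0 < E := by rw [hE']; exact Real.exp_pos _
  have h1 : Real.exp (-(δ * sdist (S y) (S y'))) ≤ E := by
    rw [hE', Real.exp_le_exp]
    nlinarith [mul_le_mul_of_nonneg_left (hρS y y') hδ]
  have h2 : |pOp w Q y y'| ≤ E := by
    by_cases hP : pOp w Q y y' = 0
    · rw [hP, abs_zero]; exact hEpos.le
    · refine (hP1 y y').trans ?_
      rw [hE', Real.one_le_exp_iff]
      nlinarith [mul_le_mul_of_nonneg_left (hρP y y' hP) hδ]
  have h3 : (if y = y' then 1 / ak else (0 : ℝ)) ≤ 1 / ak * E := by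
    split_ifs with hyy
    · subst hyy
      have : (1 : ℝ) ≤ E := by
        rw [hE', Real.one_le_exp_iff]
        nlinarith [mul_le_mul_of_nonneg_left (hρ0 y) hδ]
      have hak' : 0 ≤ 1 / ak := (one_div_pos.mpr hak).le
      nlinarith
    · exact mul_nonneg (one_div_pos.mpr hak).le hEpos.le
  have hcoef1 : 0 ≤ c * (κ * ck) := mul_nonneg hc (mul_nonneg hκ hck)
  have hcoef2 : 0 ≤ aNext a ak ℓ * ℓ / ak ^ 2 := div_nonneg hθ (sq_nonneg _)
  have e : (c * (κ * ck) + aNext a ak ℓ * ℓ / ak ^ 2 + 1 / ak) * Real.exp (δ * ρ) *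
      Real.exp (-(δ * udist y y')) = c * (κ * ck) * E + aNext a ak ℓ * ℓ / ak ^ 2 * E + 1 / ak * E := by
    rw [hE]; ring
  rw [e]
  nlinarith [mul_le_mul_of_nonneg_left h1 hcoef1, mul_le_mul_of_nonneg_left h2 hcoef2, h3, h]

end Kernel16

/-! ## §3. (1.17)–(1.18): *"δC^{(k)}_Λ(Ω,A) is given by (3.8) with the operator (3.9) instead of G_k(Ω,Λ,A) and the
inequality (3.10) implies (1.18)"* -/

section Kernel18

/-- The functions of (3.8) do not depend on `Λ` for `y ∈ Λ`: the row `y` of `tOp` built at `Λ = Ω^{(k)}` (all unit blocks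
replaced by `L`-blocks; the representation of `C^{(k)}(Ω,A) = C^{(k)}_{Ω^{(k)}}(Ω,A)`) equals the row built at `Λ`, because
no `L`-block straddles `∂Λ` (`BlockCompatible`). [cite: Balaban1983RegularityDecay, (3.7)–(3.8) p.588] -/
theorem tOp_univ_apply [Fintype Y] [Fintype Z] [DecidableEq Z] (ak : ℝ) (Qk : Matrix Y X ℝ) (a ℓ w : ℝ)
    {Q : Matrix Z Y ℝ} {Λ : Finset Y} {Λ' : Finset Z} (hB : BlockCompatible Q Λ Λ') (y : Λ) (x : X) :
    tOp ak Qk a ℓ w Q Finset.univ Finset.univ ⟨y.1, Finset.mem_univ _⟩ x = tOp ak Qk a ℓ w Q Λ Λ' y x := by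
  simp only [tOp, Matrix.submatrix_apply, id_eq, Matrix.sub_apply, Matrix.smul_apply, smul_eq_mul]
  have e : ∀ (S : Finset Z) (z : Z), (Qᵀ * diagInd S) (y : Y) z = Q z y * (if z ∈ S then 1 else 0) :=
    fun S z => by rw [diagInd, Matrix.mul_diagonal, Matrix.transpose_apply]
  congr 2
  rw [Matrix.mul_apply, Matrix.mul_apply]
  refine Finset.sum_congr rfl fun z _ => ?_
  rw [e, e]
  by_cases hQ : Q z y = 0
  · simp [hQ]
  · rw [if_pos (Finset.mem_univ z), if_pos ((hB z y hQ).mp y.2)]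

variable [Fintype X] [Fintype Y] [Fintype Z] [DecidableEq X] [DecidableEq Y] [DecidableEq Z]

/-- **(1.17) through (3.8)/(3.9)**: *"The function δC^{(k)}_Λ(Ω,A) is given by (3.8) with the operator (3.9) instead of
G_k(Ω,Λ,A)"* (p. 589) — PROVED: for `y, y′ ∈ Λ`, `δC^{(k)}_Λ(Ω,A;y,y′) = C^{(k)}_Λ(Ω,A;y,y′) − C^{(k)}(Ω,A;y,y′) = ⟨t_y,
(G_k(Ω,Λ,A) − G^η_{k+1}(Ω,A))t_{y′}⟩` (both propagators represented by the proved (3.6), `h36`/`h36U`; the local terms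
`−(a_{k+1}/a_k²)L^{−2}P + δ/a_k` cancel). [cite: Balaban1983RegularityDecay, (1.17) p.574, (3.8)–(3.9) pp.588–589] -/
theorem deltaC_apply_eq {H : Matrix X X ℝ} {ak : ℝ} {Qk : Matrix Y X ℝ} {a ℓ w : ℝ} {Q : Matrix Z Y ℝ}
    {Λ : Finset Y} {Λ' : Finset Z} (h36 : cLam H ak Qk a ℓ w Q Λ = rep36Rhs H ak Qk a ℓ w Q Λ Λ')
    (h36U : cLam H ak Qk a ℓ w Q Finset.univ = rep36Rhs H ak Qk a ℓ w Q Finset.univ Finset.univ)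
    (hB : BlockCompatible Q Λ Λ') (y y' : Λ) :
    cLam H ak Qk a ℓ w Q Λ y y' -
        cLam H ak Qk a ℓ w Q Finset.univ ⟨y.1, Finset.mem_univ _⟩ ⟨y'.1, Finset.mem_univ _⟩ =
      (fun x => tOp ak Qk a ℓ w Q Λ Λ' y x) ⬝ᵥ
        ((gLam H ak Qk a ℓ w Q Λ Λ' - gNext H ak Qk a ℓ w Q) *ᵥ fun x => tOp ak Qk a ℓ w Q Λ Λ' y' x) := by
  rw [cLam_apply_eq h36, cLam_apply_eq h36U, gNext]
  have ht : (fun x => tOp ak Qk a ℓ w Q Finset.univ Finset.univ ⟨y.1, Finset.mem_univ _⟩ x) =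
      fun x => tOp ak Qk a ℓ w Q Λ Λ' y x := funext fun x => tOp_univ_apply ak Qk a ℓ w hB y x
  have ht' : (fun x => tOp ak Qk a ℓ w Q Finset.univ Finset.univ ⟨y'.1, Finset.mem_univ _⟩ x) =
      fun x => tOp ak Qk a ℓ w Q Λ Λ' y' x := funext fun x => tOp_univ_apply ak Qk a ℓ w hB y' x
  have hite : (if (⟨y.1, Finset.mem_univ _⟩ : ↥(Finset.univ : Finset Y)) = ⟨y'.1, Finset.mem_univ _⟩
      then 1 / ak else (0 : ℝ)) = if y = y' then 1 / ak else 0 := by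
    by_cases hyy : y = y'
    · subst hyy; simp
    · have hne : (y : Y) ≠ (y' : Y) := fun e => hyy (Subtype.ext e)
      simp [hyy, hne]
  rw [ht, ht', hite, Matrix.sub_mulVec, dotProduct_sub]
  ring

/-- **(1.18), support form, from the proved (3.10)**: with `h310 : Ineq310 (G_k(Ω,Λ,A) − G^η_{k+1}(Ω,A)) ‖·‖ dist B^k(Λ)
B^k(Λ^c) c₀ δ₀` (= `B4GaussRep36.Ineq310`, PROVED in `B4Ineq310Proof` from Corollary 2.3), supports `supp t_y ⊆ S_y ⊆
B^k(Λ)` and plain square norms `t_y·t_y ≤ c_k`:  `|δC^{(k)}_Λ(Ω,A;y,y′)| ≤ c₀κc_k·exp[−δ₀(dist(S_y,S_{y′}) +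
dist(S_y,B^k(Λ^c)) + dist(S_{y′},B^k(Λ^c)))]` — *"the inequality (3.10) implies (1.18)"* (p. 589).
[cite: Balaban1983RegularityDecay, Prop. 2.3 of [1] (1.18) p.574, (3.10) p.589] -/
theorem abs_deltaC_le {H : Matrix X X ℝ} {ak : ℝ} {Qk : Matrix Y X ℝ} {a ℓ w : ℝ} {Q : Matrix Z Y ℝ}
    {Λ : Finset Y} {Λ' : Finset Z} {nrm : (X → ℝ) → ℝ} {sdist : Finset X → Finset X → ℝ}
    {bkΛ bkΛc : Finset X} {κ ck c₀ δ₀ : ℝ} (S : Λ → Finset X)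
    (h36 : cLam H ak Qk a ℓ w Q Λ = rep36Rhs H ak Qk a ℓ w Q Λ Λ')
    (h36U : cLam H ak Qk a ℓ w Q Finset.univ = rep36Rhs H ak Qk a ℓ w Q Finset.univ Finset.univ)
    (hB : BlockCompatible Q Λ Λ') (hS : ∀ (y : Λ) (x : X), x ∉ S y → tOp ak Qk a ℓ w Q Λ Λ' y x = 0)
    (hSΛ : ∀ y : Λ, S y ⊆ bkΛ)
    (hT : ∀ y : Λ, (fun x => tOp ak Qk a ℓ w Q Λ Λ' y x) ⬝ᵥ (fun x => tOp ak Qk a ℓ w Q Λ Λ' y x) ≤ ck)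
    (hn2 : ∀ u, nrm u ^ 2 = κ * (u ⬝ᵥ u)) (hκ : 0 ≤ κ) (hc₀ : 0 ≤ c₀)
    (h310 : Ineq310 (gLam H ak Qk a ℓ w Q Λ Λ' - gNext H ak Qk a ℓ w Q) nrm sdist bkΛ bkΛc c₀ δ₀)
    (y y' : Λ) :
    |cLam H ak Qk a ℓ w Q Λ y y' -
        cLam H ak Qk a ℓ w Q Finset.univ ⟨y.1, Finset.mem_univ _⟩ ⟨y'.1, Finset.mem_univ _⟩| ≤
      c₀ * (κ * ck) *
        Real.exp (-(δ₀ * (sdist (S y) (S y') + sdist (S y) bkΛc + sdist (S y') bkΛc))) := by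
  rw [deltaC_apply_eq h36 h36U hB]
  exact bilinear_to_const hn2 hκ hc₀ (Real.exp_pos _).le (hT y) (hT y')
    (h310 _ _ (S y) (S y') (hSΛ y) (hSΛ y') (hS y) (hS y'))

/-- **(1.18) AS PRINTED (point form, explicit constant)**: if the unit-lattice distances are dominated by the support
distances up to the block diameter `ρ` (`|y−y′| ≤ dist(S_y,S_{y′}) + ρ`, `dist(y,Λ^c) ≤ dist(S_y,B^k(Λ^c)) + ρ`), then
`|δC^{(k)}_Λ(Ω,A;y,y′)| ≤ c₀κc_k e^{3δ₀ρ}·exp[−δ₀(|y−y′| + dist(y,Λ^c) + dist(y′,Λ^c))]` — *"|δC^{(k)}_Λ(Ω,A; x,x′)| ≤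
c₀ exp(−δ₀(|x−x′| + dist(x,Λᶜ) + dist(x′,Λᶜ))), x, x′ ∈ Λ. (1.18)"*.
[cite: Balaban1983RegularityDecay, Prop. 2.3 of [1] (1.18) p.574, (3.10) p.589] -/
theorem abs_deltaC_le_exp {H : Matrix X X ℝ} {ak : ℝ} {Qk : Matrix Y X ℝ} {a ℓ w : ℝ} {Q : Matrix Z Y ℝ}
    {Λ : Finset Y} {Λ' : Finset Z} {nrm : (X → ℝ) → ℝ} {sdist : Finset X → Finset X → ℝ}
    {bkΛ bkΛc : Finset X} {κ ck c₀ δ₀ : ℝ} (S : Λ → Finset X)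
    (h36 : cLam H ak Qk a ℓ w Q Λ = rep36Rhs H ak Qk a ℓ w Q Λ Λ')
    (h36U : cLam H ak Qk a ℓ w Q Finset.univ = rep36Rhs H ak Qk a ℓ w Q Finset.univ Finset.univ)
    (hB : BlockCompatible Q Λ Λ') (hS : ∀ (y : Λ) (x : X), x ∉ S y → tOp ak Qk a ℓ w Q Λ Λ' y x = 0)
    (hSΛ : ∀ y : Λ, S y ⊆ bkΛ)
    (hT : ∀ y : Λ, (fun x => tOp ak Qk a ℓ w Q Λ Λ' y x) ⬝ᵥ (fun x => tOp ak Qk a ℓ w Q Λ Λ' y x) ≤ ck)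
    (hn2 : ∀ u, nrm u ^ 2 = κ * (u ⬝ᵥ u)) (hκ : 0 ≤ κ) (hck : 0 ≤ ck) (hc₀ : 0 ≤ c₀)
    (h310 : Ineq310 (gLam H ak Qk a ℓ w Q Λ Λ' - gNext H ak Qk a ℓ w Q) nrm sdist bkΛ bkΛc c₀ δ₀)
    {udist : Y → Y → ℝ} {distLc : Y → ℝ} {ρ : ℝ} (hδ : 0 ≤ δ₀)
    (hρS : ∀ y y' : Λ, udist y y' ≤ sdist (S y) (S y') + ρ) (hρL : ∀ y : Λ, distLc y ≤ sdist (S y) bkΛc + ρ)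
    (y y' : Λ) :
    |cLam H ak Qk a ℓ w Q Λ y y' -
        cLam H ak Qk a ℓ w Q Finset.univ ⟨y.1, Finset.mem_univ _⟩ ⟨y'.1, Finset.mem_univ _⟩| ≤
      c₀ * (κ * ck) * Real.exp (3 * (δ₀ * ρ)) *
        Real.exp (-(δ₀ * (udist y y' + distLc y + distLc y'))) := by
  have h := abs_deltaC_le S h36 h36U hB hS hSΛ hT hn2 hκ hc₀ h310 y y'
  refine h.trans ?_
  rw [mul_assoc (c₀ * (κ * ck)), ← Real.exp_add]
  refine mul_le_mul_of_nonneg_left (Real.exp_le_exp.mpr ?_) (mul_nonneg hc₀ (mul_nonneg hκ hck))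
  nlinarith [mul_le_mul_of_nonneg_left (hρS y y') hδ, mul_le_mul_of_nonneg_left (hρL y) hδ,
    mul_le_mul_of_nonneg_left (hρL y') hδ]

end Kernel18

/-! ## §4. (1.19)–(1.20): the region difference in the same currency -/

section Kernel20

variable [Fintype X] [Fintype Y] [Fintype Z] [DecidableEq X] [DecidableEq Y] [DecidableEq Z]

/-- **(1.19)–(1.20), support form**: *"Finally, for Ω ⊂ Ω₀ and δC^{(k)}_Λ(Ω,Ω₀,A) = C^{(k)}_Λ(Ω,A) − C^{(k)}_Λ(Ω₀,A),
(1.19) we have |δC^{(k)}_Λ(Ω,Ω₀,A; x,x′)| ≤ c₀ exp(−δ₀(|x−x′| + dist(x,Ω^{(k)c}) + dist(x′,Ω^{(k)c}))) (1.20)"* — again a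
*"simple consequence of Corollary 2.3"* (its second member, for `δG_k(Ω,Ω₀,A)`, *"with the additional factor
e^{−δ₀(dist(supp f,Ωᶜ) + dist(supp f′,Ωᶜ))}"*, p. 581): in the dictionary the two propagators are `gLam H …` and
`gLam H₀ …` for two background operators on a common site set (`H` = the form of `−Δ^{η,N}_{A,Ω} + m_k²` extended
block-diagonally to the sites of `Ω₀`, `H₀` that of `Ω₀`; the averaging data and hence `T` are the same), both
represented by the proved (3.6); the (2.30)(ii)-shape decay of their difference is the hypothesis `hGd` (`bOc` ↤
`B^k(Ω^{(k)c})`).  Conclusion: `|δC^{(k)}_Λ(Ω,Ω₀,A;y,y′)| ≤ cκc_k·exp[−δ(dist(S_y,S_{y′}) + dist(S_y,bOc) + dist(S_{y′},bOc))]`.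
[cite: Balaban1983RegularityDecay, Prop. 2.3 of [1] (1.19)–(1.20) p.574, (3.8) p.588] -/
theorem abs_deltaC_region_le {H H₀ : Matrix X X ℝ} {ak : ℝ} {Qk : Matrix Y X ℝ} {a ℓ w : ℝ}
    {Q : Matrix Z Y ℝ} {Λ : Finset Y} {Λ' : Finset Z} {nrm : (X → ℝ) → ℝ}
    {sdist : Finset X → Finset X → ℝ} {bOc : Finset X} {κ ck c δ : ℝ} (S : Λ → Finset X)
    (h36 : cLam H ak Qk a ℓ w Q Λ = rep36Rhs H ak Qk a ℓ w Q Λ Λ')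
    (h36₀ : cLam H₀ ak Qk a ℓ w Q Λ = rep36Rhs H₀ ak Qk a ℓ w Q Λ Λ')
    (hS : ∀ (y : Λ) (x : X), x ∉ S y → tOp ak Qk a ℓ w Q Λ Λ' y x = 0)
    (hT : ∀ y : Λ, (fun x => tOp ak Qk a ℓ w Q Λ Λ' y x) ⬝ᵥ (fun x => tOp ak Qk a ℓ w Q Λ Λ' y x) ≤ ck)
    (hn2 : ∀ u, nrm u ^ 2 = κ * (u ⬝ᵥ u)) (hκ : 0 ≤ κ) (hc : 0 ≤ c)
    (hGd : ∀ (g g' : X → ℝ) (T T' : Finset X), (∀ x ∉ T, g x = 0) → (∀ x ∉ T', g' x = 0) →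
      |g ⬝ᵥ ((gLam H ak Qk a ℓ w Q Λ Λ' - gLam H₀ ak Qk a ℓ w Q Λ Λ') *ᵥ g')| ≤
        c * nrm g * nrm g' * Real.exp (-(δ * (sdist T T' + sdist T bOc + sdist T' bOc))))
    (y y' : Λ) :
    |cLam H ak Qk a ℓ w Q Λ y y' - cLam H₀ ak Qk a ℓ w Q Λ y y'| ≤
      c * (κ * ck) * Real.exp (-(δ * (sdist (S y) (S y') + sdist (S y) bOc + sdist (S y') bOc))) := by
  have e : cLam H ak Qk a ℓ w Q Λ y y' - cLam H₀ ak Qk a ℓ w Q Λ y y' =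
      (fun x => tOp ak Qk a ℓ w Q Λ Λ' y x) ⬝ᵥ
        ((gLam H ak Qk a ℓ w Q Λ Λ' - gLam H₀ ak Qk a ℓ w Q Λ Λ') *ᵥ fun x => tOp ak Qk a ℓ w Q Λ Λ' y' x) := by
    rw [cLam_apply_eq h36, cLam_apply_eq h36₀, Matrix.sub_mulVec, dotProduct_sub]
    ring
  rw [e]
  exact bilinear_to_const hn2 hκ hc (Real.exp_pos _).le (hT y) (hT y') (hGd _ _ (S y) (S y') (hS y) (hS y'))

end Kernel20

/-! ## §5. (v1.1) The geometric hypotheses from a metric embedding of the lattices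

The point forms above carry the block-diameter hypotheses `hρS`, `hρP`, `hρ0`, `hρL` relating the unit-lattice
distances `|y−y′|`, `dist(y,Λ^c)` to the support distances of Corollary 2.3.  Here they are DERIVED from primitive
geometry: the `η`-sites and the unit-lattice points are embedded in one (pseudo)metric space (`e`, `eY`, `eZ` — in the
model the inclusions `ηℤ^d, ℤ^d, Lℤ^d ⊂ ℝ^d`), every support `S_y` lies within `ρ/2` of `y` and every unit point within
`ρ/2` of its `L`-block point, `dist(y,Λ^c)` is at most the distance to any point of `Λ^c`, and the set distance of the
Corollary 2.3 input is the greatest lower bound of the pairwise distances (`hglb`). -/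

section Geometry

variable {V : Type*} [PseudoMetricSpace V]

/-- `|y−y′| ≤ dist(S_y,S_{y′}) + ρ` when `S_y ⊆ B(y, ρ/2)`, `S_{y′} ⊆ B(y′, ρ/2)` (triangle inequality; `dist` of the set
distance = greatest lower bound of the pairwise site distances) — the hypothesis `hρS` of `abs_cLam_le_exp` /
`abs_deltaC_le_exp`. [cite: Balaban1983RegularityDecay, Prop. 2.3 of [1] (1.16) p.574, (3.7)–(3.8) p.588] -/
theorem dist_le_sdist_add (e : X → V) (eY : Y → V) {Λ : Finset Y} (S : Λ → Finset X)
    {sdist : Finset X → Finset X → ℝ} {ρ : ℝ}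
    (hglb : ∀ (T T' : Finset X) (m : ℝ), T.Nonempty → T'.Nonempty →
      (∀ x ∈ T, ∀ x' ∈ T', m ≤ dist (e x) (e x')) → m ≤ sdist T T')
    (hne : ∀ y : Λ, (S y).Nonempty) (hnear : ∀ (y : Λ) (x : X), x ∈ S y → dist (e x) (eY y) ≤ ρ / 2)
    (y y' : Λ) : dist (eY y) (eY y') ≤ sdist (S y) (S y') + ρ := by
  have h := hglb (S y) (S y') (dist (eY y) (eY y') - ρ) (hne y) (hne y') fun x hx x' hx' => by
    have h4 := dist_triangle4 (eY y) (e x) (e x') (eY y')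
    rw [dist_comm (eY y) (e x)] at h4
    linarith [hnear y x hx, hnear y' x' hx']
  linarith

/-- `dist(y,Λ^c) ≤ dist(S_y,B^k(Λ^c)) + ρ`: every site of `B^k(Λ^c)` lies within `ρ/2` of a point of `Λ^c` and `S_y`
within `ρ/2` of `y` — the hypothesis `hρL` of `abs_deltaC_le_exp` (for `B^k(Λ^c) ≠ ∅`).
[cite: Balaban1983RegularityDecay, Prop. 2.3 of [1] (1.18) p.574, (3.10) p.589] -/
theorem distLc_le_sdist_add (e : X → V) (eY : Y → V) {Λ : Finset Y} (S : Λ → Finset X)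
    {sdist : Finset X → Finset X → ℝ} {ρ : ℝ}
    (hglb : ∀ (T T' : Finset X) (m : ℝ), T.Nonempty → T'.Nonempty →
      (∀ x ∈ T, ∀ x' ∈ T', m ≤ dist (e x) (e x')) → m ≤ sdist T T')
    (hne : ∀ y : Λ, (S y).Nonempty) (hnear : ∀ (y : Λ) (x : X), x ∈ S y → dist (e x) (eY y) ≤ ρ / 2)
    {distLc : Y → ℝ} {bkΛc : Finset X} (hLc : ∀ (y : Λ) (y'' : Y), y'' ∉ Λ → distLc y ≤ dist (eY y) (eY y''))
    (hbk : ∀ x' ∈ bkΛc, ∃ y'' : Y, y'' ∉ Λ ∧ dist (e x') (eY y'') ≤ ρ / 2) (hbne : bkΛc.Nonempty) (y : Λ) :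
    distLc y ≤ sdist (S y) bkΛc + ρ := by
  have h := hglb (S y) bkΛc (distLc y - ρ) (hne y) hbne fun x hx x' hx' => by
    obtain ⟨y'', hy'', hd⟩ := hbk x' hx'
    have hL := hLc y y'' hy''
    have h4 := dist_triangle4 (eY y) (e x) (e x') (eY y'')
    rw [dist_comm (eY y) (e x)] at h4
    linarith [hnear y x hx]
  linarith

/-- `P(A;y,y′) ≠ 0 ⇒ |y−y′| ≤ ρ`: a non-zero entry of `P = wQᵀQ` needs an `L`-block point `z` with `Q(z,y) ≠ 0 ≠ Q(z,y′)`,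
and both `y, y′` lie within `ρ/2` of their `L`-block point — the hypothesis `hρP` of `abs_cLam_le_exp`.
[cite: Balaban1983RegularityDecay, (1.5) p.572, (3.2) p.587] -/
theorem dist_le_of_pOp_ne_zero [Fintype Z] {w : ℝ} {Q : Matrix Z Y ℝ} (eY : Y → V) (eZ : Z → V) {ρ : ℝ}
    (hQnear : ∀ z y, Q z y ≠ 0 → dist (eY y) (eZ z) ≤ ρ / 2) {y y' : Y} (h : pOp w Q y y' ≠ 0) :
    dist (eY y) (eY y') ≤ ρ := by
  rw [pOp, Matrix.smul_apply, smul_eq_mul, Matrix.mul_apply] at h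
  obtain ⟨z, _, hz⟩ := Finset.exists_ne_zero_of_sum_ne_zero (right_ne_zero_of_mul h)
  rw [Matrix.transpose_apply, mul_ne_zero_iff] at hz
  have h1 := hQnear z y hz.1
  have h2 := hQnear z y' hz.2
  rw [dist_comm] at h2
  linarith [dist_triangle (eY y) (eZ z) (eY y')]

variable [Fintype X] [Fintype Y] [Fintype Z] [DecidableEq X] [DecidableEq Y] [DecidableEq Z]

/-- **(1.16) AS PRINTED, metric form**: *"|C^{(k)}_Λ(Ω,A; x,x′)| ≤ c₀ exp(−δ₀|x−x′|), x, x′ ∈ Λ. (1.16)"* with `|y−y′| =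
dist(eY y, eY y′)` in a common embedding of the lattices and `c₀ ↦ (cκc_k + a_{k+1}L^{−2}/a_k² + a_k⁻¹)e^{δρ}`; the
geometric inputs are the `ρ/2`-localisation of the supports `S_y` and of the `L`-blocks and the glb property of the set
distance; the analytic input is Corollary 2.3 for `G_k(Ω,Λ,A)` (`hG`). [cite: Balaban1983RegularityDecay, Prop. 2.3 of [1] (1.16) p.574, (3.8) p.588] -/
theorem abs_cLam_le_dist {H : Matrix X X ℝ} {ak : ℝ} {Qk : Matrix Y X ℝ} {a ℓ w : ℝ} {Q : Matrix Z Y ℝ}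
    {Λ : Finset Y} {Λ' : Finset Z} {nrm : (X → ℝ) → ℝ} {sdist : Finset X → Finset X → ℝ} {κ ck c δ : ℝ}
    (S : Λ → Finset X) (h36 : cLam H ak Qk a ℓ w Q Λ = rep36Rhs H ak Qk a ℓ w Q Λ Λ')
    (hS : ∀ (y : Λ) (x : X), x ∉ S y → tOp ak Qk a ℓ w Q Λ Λ' y x = 0)
    (hT : ∀ y : Λ, (fun x => tOp ak Qk a ℓ w Q Λ Λ' y x) ⬝ᵥ (fun x => tOp ak Qk a ℓ w Q Λ Λ' y x) ≤ ck)
    (hn2 : ∀ u, nrm u ^ 2 = κ * (u ⬝ᵥ u)) (hκ : 0 ≤ κ) (hc : 0 ≤ c) (hck : 0 ≤ ck) (hak : 0 < ak)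
    (hθ : 0 ≤ aNext a ak ℓ * ℓ) (hQ : RowOrtho w Q) (hw : w ≠ 0)
    (hG : ∀ (g g' : X → ℝ) (T T' : Finset X), (∀ x ∉ T, g x = 0) → (∀ x ∉ T', g' x = 0) →
      |g ⬝ᵥ (gLam H ak Qk a ℓ w Q Λ Λ' *ᵥ g')| ≤ c * nrm g * nrm g' * Real.exp (-(δ * sdist T T')))
    (hδ : 0 ≤ δ) (e : X → V) (eY : Y → V) (eZ : Z → V) {ρ : ℝ} (hρ : 0 ≤ ρ)
    (hglb : ∀ (T T' : Finset X) (m : ℝ), T.Nonempty → T'.Nonempty →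
      (∀ x ∈ T, ∀ x' ∈ T', m ≤ dist (e x) (e x')) → m ≤ sdist T T')
    (hne : ∀ y : Λ, (S y).Nonempty) (hnear : ∀ (y : Λ) (x : X), x ∈ S y → dist (e x) (eY y) ≤ ρ / 2)
    (hQnear : ∀ z y, Q z y ≠ 0 → dist (eY y) (eZ z) ≤ ρ / 2) (y y' : Λ) :
    |cLam H ak Qk a ℓ w Q Λ y y'| ≤
      (c * (κ * ck) + aNext a ak ℓ * ℓ / ak ^ 2 + 1 / ak) * Real.exp (δ * ρ) *
        Real.exp (-(δ * dist (eY y) (eY y'))) := by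
  -- `|P(y,y′)| ≤ 1` for the projection `P` (from `P² = P`, `Pᵀ = P`)
  have hP1 : ∀ p p' : Λ, |pOp w Q p p'| ≤ 1 := by
    intro p p'
    have hPP : pOp w Q * pOp w Q = pOp w Q := by
      have hQ' : Q * Qᵀ = w⁻¹ • (1 : Matrix Z Z ℝ) := hQ
      calc pOp w Q * pOp w Q = (w * w) • (Qᵀ * (Q * Qᵀ) * Q) := by
            simp only [pOp, Matrix.smul_mul, Matrix.mul_smul, smul_smul, Matrix.mul_assoc]
        _ = (w * w * w⁻¹) • (Qᵀ * Q) := by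
            rw [hQ']
            simp only [Matrix.smul_mul, Matrix.mul_smul, smul_smul, Matrix.mul_one]
        _ = pOp w Q := by rw [mul_inv_cancel_right₀ hw, pOp]
    have hsym : ∀ i j, pOp w Q i j = pOp w Q j i := fun i j => by
      have hPt : (pOp w Q)ᵀ = pOp w Q := by
        rw [pOp, Matrix.transpose_smul, Matrix.transpose_mul, Matrix.transpose_transpose]
      simpa [Matrix.transpose_apply] using congrFun (congrFun hPt j) i
    have hdiag : pOp w Q p p = ∑ z, pOp w Q p z ^ 2 := by
      have hd := congrFun (congrFun hPP p) p
      rw [Matrix.mul_apply] at hd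
      rw [← hd]
      exact Finset.sum_congr rfl fun z _ => by rw [sq, hsym z p]
    have h1 : pOp w Q p p' ^ 2 ≤ ∑ z, pOp w Q p z ^ 2 :=
      Finset.single_le_sum (fun z _ => sq_nonneg (pOp w Q p z)) (Finset.mem_univ (p' : Y))
    have h2 : pOp w Q p p ^ 2 ≤ ∑ z, pOp w Q p z ^ 2 :=
      Finset.single_le_sum (fun z _ => sq_nonneg (pOp w Q p z)) (Finset.mem_univ (p : Y))
    rw [← hdiag] at h1 h2
    have h3 : pOp w Q p p ≤ 1 := by nlinarith
    exact (sq_le_one_iff_abs_le_one _).mp (h1.trans h3)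
  exact abs_cLam_le_exp S h36 hS hT hn2 hκ hc hck hak hθ hG (udist := fun y y' => dist (eY y) (eY y')) hδ
    (fun p p' => dist_le_sdist_add e eY S hglb hne hnear p p')
    (fun p p' hP => dist_le_of_pOp_ne_zero eY eZ hQnear hP)
    (fun p => by rw [dist_self]; exact hρ) hP1 y y'

/-- **(1.18) AS PRINTED, metric form**: *"|δC^{(k)}_Λ(Ω,A; x,x′)| ≤ c₀ exp(−δ₀(|x−x′| + dist(x,Λᶜ) + dist(x′,Λᶜ))), x, x′
∈ Λ. (1.18)"* with the distances read in a common embedding of the lattices, `dist(y,Λ^c)` any function bounded by the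
distance to each point of `Λ^c`, `c₀ ↦ c₀κc_k e^{3δ₀ρ}`; inputs: the proved (3.6) at `Λ` and at `Ω^{(k)}`, the proved
(3.10) (`h310`), the `ρ/2`-localisation of the supports and of `B^k(Λ^c)` (each of its sites within `ρ/2` of a point
of `Λ^c`), the glb property of the set distance. [cite: Balaban1983RegularityDecay, Prop. 2.3 of [1] (1.18) p.574, (3.10) p.589] -/
theorem abs_deltaC_le_dist {H : Matrix X X ℝ} {ak : ℝ} {Qk : Matrix Y X ℝ} {a ℓ w : ℝ} {Q : Matrix Z Y ℝ}
    {Λ : Finset Y} {Λ' : Finset Z} {nrm : (X → ℝ) → ℝ} {sdist : Finset X → Finset X → ℝ}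
    {bkΛ bkΛc : Finset X} {κ ck c₀ δ₀ : ℝ} (S : Λ → Finset X)
    (h36 : cLam H ak Qk a ℓ w Q Λ = rep36Rhs H ak Qk a ℓ w Q Λ Λ')
    (h36U : cLam H ak Qk a ℓ w Q Finset.univ = rep36Rhs H ak Qk a ℓ w Q Finset.univ Finset.univ)
    (hB : BlockCompatible Q Λ Λ') (hS : ∀ (y : Λ) (x : X), x ∉ S y → tOp ak Qk a ℓ w Q Λ Λ' y x = 0)
    (hSΛ : ∀ y : Λ, S y ⊆ bkΛ)
    (hT : ∀ y : Λ, (fun x => tOp ak Qk a ℓ w Q Λ Λ' y x) ⬝ᵥ (fun x => tOp ak Qk a ℓ w Q Λ Λ' y x) ≤ ck)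
    (hn2 : ∀ u, nrm u ^ 2 = κ * (u ⬝ᵥ u)) (hκ : 0 ≤ κ) (hck : 0 ≤ ck) (hc₀ : 0 ≤ c₀)
    (h310 : Ineq310 (gLam H ak Qk a ℓ w Q Λ Λ' - gNext H ak Qk a ℓ w Q) nrm sdist bkΛ bkΛc c₀ δ₀)
    (hδ : 0 ≤ δ₀) (e : X → V) (eY : Y → V) {ρ : ℝ}
    (hglb : ∀ (T T' : Finset X) (m : ℝ), T.Nonempty → T'.Nonempty →
      (∀ x ∈ T, ∀ x' ∈ T', m ≤ dist (e x) (e x')) → m ≤ sdist T T')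
    (hne : ∀ y : Λ, (S y).Nonempty) (hnear : ∀ (y : Λ) (x : X), x ∈ S y → dist (e x) (eY y) ≤ ρ / 2)
    {distLc : Y → ℝ} (hLc : ∀ (y : Λ) (y'' : Y), y'' ∉ Λ → distLc y ≤ dist (eY y) (eY y''))
    (hbk : ∀ x' ∈ bkΛc, ∃ y'' : Y, y'' ∉ Λ ∧ dist (e x') (eY y'') ≤ ρ / 2) (hbne : bkΛc.Nonempty) (y y' : Λ) :
    |cLam H ak Qk a ℓ w Q Λ y y' -
        cLam H ak Qk a ℓ w Q Finset.univ ⟨y.1, Finset.mem_univ _⟩ ⟨y'.1, Finset.mem_univ _⟩| ≤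
      c₀ * (κ * ck) * Real.exp (3 * (δ₀ * ρ)) *
        Real.exp (-(δ₀ * (dist (eY y) (eY y') + distLc y + distLc y'))) :=
  abs_deltaC_le_exp S h36 h36U hB hS hSΛ hT hn2 hκ hck hc₀ h310 (udist := fun y y' => dist (eY y) (eY y'))
    (distLc := distLc) hδ (fun p p' => dist_le_sdist_add e eY S hglb hne hnear p p')
    (fun p => distLc_le_sdist_add e eY S hglb hne hnear hLc hbk hbne p) y y'

end Geometry

end Literature.MathematicalPhysics.QuantumFieldTheory.Balaban1983to89.B4Prop23Sect3Route
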